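import Mathlib
import Summits.NavierStokesRegularity.NavierStokesRegularity.Theorems.TypeIQuarterGateQuarterZoomTypeIClock
import Summits.NavierStokesRegularity.NavierStokesRegularity.Theorems.NoBlowupToClay
import HarnessLib

/-!
# `TypeIQuarterGate`: the quarter zoom keeps BOTH clocks — velocity `√(−s)‖v(s,y)‖ ≤ C'` AND
# enstrophy `√(−s)·∫|∇v(s)|²_F ≤ K'` (the quarter law passes to the zoom limit)

Helper file for crux `QuarterLawTypeI` (stmt-NavierStokesRegularity-23726), companion of
`TypeIQuarterGateQuarterZoomTypeIClock` / `…PerSolution` (theorems only, no definitions). Besides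
the velocity Type-I clock, the QUARTER LAW itself survives the zoom: the Dirichlet integral of the
zoom slice is `∫|∇z_n(s)|²_F = ∫|∇u(τ_n(s))|²_F / L_n ≤ K/(L_n√(T−τ_n(s))) ≤ max K 0/(ν√ν√(−s))`
(`zoom_enstrophy_bound`, since `T − τ_n(s) ≥ ν³(−s)/L_n²`), uniformly in `n`, and the tree's lower
semicontinuity of `∫|∇·|²` under bounded pointwise convergence of `C¹` fields
(`RecordZoomAncient.Birth.lintegral_frobeniusNormSq_fderiv_le_of_tendsto_of_bound`) passes it to
the limit. So the zoom limit of a Type-I blow-up obeying the quarter law is a bounded ancient mild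
solution whose similarity-variable profiles `V(τ) = √(−s)·v(s, √(−s)·)` are UNIFORMLY BOUNDED with
UNIFORMLY BOUNDED DIRICHLET INTEGRAL — a "Leray backward-similarity-RATE" ancient flow.

* `QuarterZoomTypeIClock.quarterZoom_clocks_of_rate` — per-solution statement with explicit
  constants: velocity clock `max C_I 0/√ν`, enstrophy clock `max K 0/(ν√ν)`.
* `typeIQuarterGate_of_lerayRateLiouville` — `QuarterLawTypeI → NoTypeII → LRL →
  NavierStokesRegularity`, where LRL ("Leray-rate Liouville", spelled inline) = X2 ⟨0893⟩ with the
  two extra clock hypotheses; LRL ⟸ TQAL ⟸ X2 (`lerayRateLiouville_of_typeIClockLiouville`). Its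
  exactly self-similar sub-case is Tsai's theorem (profiles in `L⁶` with `∇V ∈ L²`); the general case
  is the Type-I exclusion problem in Leray's class — OPEN.

HONEST FRAMING: statements about HYPOTHETICAL blow-ups and implications between open statements;
nothing here bears on Navier–Stokes regularity. References: KNSS 2009 §6; Leray 1934 §20; Tsai 1998.
-/

noncomputable section

set_option linter.dupNamespace false

namespace Summit.NavierStokesRegularity.NavierStokesRegularity.Theorems

open Set MeasureTheory Filter Topology Function
open scoped ENNReal NNReal
open Literature.Analysis.FluidPDE
open RecordZoomAncient.Birth

namespace QuarterZoomTypeIClock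

/-- The one-zoom Dirichlet estimate. For a field `u` on `[0,T)` whose Frobenius enstrophy obeys the
quarter law `∫|∇u(τ)|²_F ≤ K/√(T−τ)` at the rescaled time `τ = tc + ν³s/L² ∈ [0,T)` (`s < 0`),
the zoom slice `(ν/L) u(τ, X₀ + ν²·/L)` has
`∫|∇z|²_F ≤ max K 0/(ν√ν√(−s))` (scaling `∫|∇z|² = ∫|∇u(τ)|²/L` and `T − τ ≥ ν³(−s)/L²`). -/
theorem zoom_enstrophy_bound {ν T K tc L s : ℝ}
    {u : ℝ → EuclideanSpace ℝ (Fin 3) → EuclideanSpace ℝ (Fin 3)}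
    (hν : 0 < ν) (htcT : tc < T) (hL : 0 < L) (hs : s < 0)
    (hτT : tc + ν ^ 3 / L ^ 2 * s ∈ Set.Ico 0 T)
    (hdiff : Differentiable ℝ (u (tc + ν ^ 3 / L ^ 2 * s)))
    (hfrobτ : ∫⁻ x, ENNReal.ofReal (frobeniusNormSq (fderiv ℝ (u (tc + ν ^ 3 / L ^ 2 * s)) x)) ≤
      ENNReal.ofReal (K / Real.sqrt (T - (tc + ν ^ 3 / L ^ 2 * s))))
    (X₀ : EuclideanSpace ℝ (Fin 3)) :
    ∫⁻ y, ENNReal.ofReal (frobeniusNormSq (fderiv ℝ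
        ((ν / L) • fun y => u (tc + ν ^ 3 / L ^ 2 * s) (X₀ + (ν ^ 2 / L) • y)) y)) ≤
      ENNReal.ofReal (max K 0 / (ν * Real.sqrt ν * Real.sqrt (-s))) := by
  set τ : ℝ := tc + ν ^ 3 / L ^ 2 * s with hτ
  have hγ : 0 < ν ^ 2 / L := div_pos (pow_pos hν 2) hL
  have hγ3 : 0 < (ν ^ 2 / L) ^ 3 := pow_pos hγ 3
  have hTτ : 0 < T - τ := sub_pos.2 hτT.2
  have hsq : 0 < Real.sqrt (T - τ) := Real.sqrt_pos.2 hTτ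
  have hsν : 0 < Real.sqrt ν := Real.sqrt_pos.2 hν
  have hss : 0 < Real.sqrt (-s) := Real.sqrt_pos.2 (neg_pos.2 hs)
  have hK0 : 0 ≤ max K 0 := le_max_right _ _
  -- `ν³(−s) ≤ L²(T − τ)`, hence `ν√ν√(−s) ≤ L√(T−τ)`
  have hkey : ν ^ 3 * (-s) ≤ L ^ 2 * (T - τ) := by
    have hid : L ^ 2 * (T - τ) = L ^ 2 * (T - tc) + ν ^ 3 * (-s) := by
      rw [hτ]; field_simp; ring
    rw [hid]
    have : 0 ≤ L ^ 2 * (T - tc) := mul_nonneg (pow_pos hL 2).le (sub_pos.2 htcT).le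
    linarith
  have hden : ν * Real.sqrt ν * Real.sqrt (-s) ≤ L * Real.sqrt (T - τ) := by
    have h := sqrt_neg_mul_le hν hL hTτ hs hkey
    calc ν * Real.sqrt ν * Real.sqrt (-s) = Real.sqrt (-s) * ν * Real.sqrt ν := by ring
      _ ≤ L * Real.sqrt (T - τ) := h
  rw [lintegral_frobeniusNormSq_fderiv_smul_comp_space_affine hγ (ν / L) X₀ hdiff,
    finrank_euclideanSpace_fin]
  have hscale : (ν / L * (ν ^ 2 / L)) ^ 2 * ((ν ^ 2 / L) ^ 3)⁻¹ * (max K 0 / Real.sqrt (T - τ)) =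
      max K 0 / (L * Real.sqrt (T - τ)) := by
    field_simp
  calc ENNReal.ofReal ((ν / L * (ν ^ 2 / L)) ^ 2) * ENNReal.ofReal ((ν ^ 2 / L) ^ 3)⁻¹ *
        ∫⁻ x, ENNReal.ofReal (frobeniusNormSq (fderiv ℝ (u τ) x))
      ≤ ENNReal.ofReal ((ν / L * (ν ^ 2 / L)) ^ 2) * ENNReal.ofReal ((ν ^ 2 / L) ^ 3)⁻¹ *
          ENNReal.ofReal (max K 0 / Real.sqrt (T - τ)) := by
        gcongr
        exact hfrobτ.trans (ENNReal.ofReal_le_ofReal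
          (div_le_div_of_nonneg_right (le_max_left _ _) hsq.le))
    _ = ENNReal.ofReal ((ν / L * (ν ^ 2 / L)) ^ 2 * ((ν ^ 2 / L) ^ 3)⁻¹ *
          (max K 0 / Real.sqrt (T - τ))) := by
        rw [← ENNReal.ofReal_mul (sq_nonneg _),
          ← ENNReal.ofReal_mul (mul_nonneg (sq_nonneg _) (inv_nonneg.2 hγ3.le))]
    _ = ENNReal.ofReal (max K 0 / (L * Real.sqrt (T - τ))) := by rw [hscale]
    _ ≤ ENNReal.ofReal (max K 0 / (ν * Real.sqrt ν * Real.sqrt (-s))) :=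
        ENNReal.ofReal_le_ofReal (div_le_div_of_nonneg_left hK0 (by positivity) hden)

/-- **Both clocks of the quarter zoom, per solution, explicit constants.** A classical Leray–Hopf
solution on `[0,T)` from a rapidly decaying datum with no smooth extension past `T`, velocity-Type-I
near `T` with constant `C_I` and obeying the quarter law `∫|curl u(t)|² ≤ K/√(T−t)` on `[0,T)`, has a
zoom limit `v`: a NONTRIVIAL bounded ancient mild solution (`ν = 1`), smooth, slice enstrophy `≤ 1`,
`L⁶` slices, with `√(−s)‖v(s,y)‖ ≤ max C_I 0/√ν` and `∫|∇v(s)|²_F ≤ max K 0/(ν√ν√(−s))`, `s < 0`.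
[cite: KochNadirashviliSereginSverak2009, §6 (Type-I zoom limits)] [cite: Leray1934, §20] -/
theorem quarterZoom_clocks_of_rate
    (ν T : ℝ) (hν : 0 < ν) (hT : 0 < T)
    (u : ℝ → EuclideanSpace ℝ (Fin 3) → EuclideanSpace ℝ (Fin 3))
    (p : ℝ → EuclideanSpace ℝ (Fin 3) → ℝ)
    (hcl : IsClassicalNSSolutionOn (Set.Ico 0 T) ν 0 u p) (hLH : IsLerayHopfOn T ν 0 (u 0) u)
    (hdec : HasRapidSpatialDecay (u 0)) (hnext : ¬ HasSmoothExtensionPast ν 0 u T)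
    (CI : ℝ) (hCI : ∀ᶠ t in 𝓝[<] T, ∀ x, ‖u t x‖ ≤ CI / Real.sqrt (T - t))
    (K : ℝ) (hK : ∀ t ∈ Set.Ico 0 T,
      ∫⁻ x, ‖curl (u t) x‖ₑ ^ 2 ≤ ENNReal.ofReal (K / Real.sqrt (T - t))) :
    ∃ v : ℝ → EuclideanSpace ℝ (Fin 3) → EuclideanSpace ℝ (Fin 3),
      IsBoundedAncientMildSolution 1 v ∧
      ContDiffOn ℝ (⊤ : ℕ∞) (Function.uncurry v) (Set.Iio 0 ×ˢ Set.univ) ∧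
      (∀ s < 0, ∫⁻ y, ENNReal.ofReal (frobeniusNormSq (fderiv ℝ (v s) y)) ≤ 1) ∧
      (∀ s < 0, MemLp (v s) 6 volume) ∧ ¬ (∀ s < 0, ∀ y, v s y = 0) ∧
      (∀ s < 0, ∀ y, Real.sqrt (-s) * ‖v s y‖ ≤ max CI 0 / Real.sqrt ν) ∧
      ∀ s < 0, ∫⁻ y, ENNReal.ofReal (frobeniusNormSq (fderiv ℝ (v s) y)) ≤
        ENNReal.ofReal (max K 0 / (ν * Real.sqrt ν * Real.sqrt (-s))) := by
  have hrep : ∀ T' ∈ Set.Ioo 0 T, ∃ P : ℝ → EuclideanSpace ℝ (Fin 3) → ℝ,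
      IsTaoSolutionOn T' ν (u 0) u P :=
    stub_taoRep ν T hν hT u p hcl hLH hdec
  obtain ⟨cP, KP, hcP, hKP, hpers⟩ := stub_enstrophyPersistence
  have hpers' := hpers ν T hν hT u p hcl hrep
  obtain ⟨cL, hcL, hLer⟩ := leray_blowup_rate_top_holds
  have hstrip : ∀ T' ∈ Set.Ioo 0 T,
      eLpNorm (uncurry u) ∞ (volume.restrict (Set.Icc 0 T' ×ˢ univ)) < ∞ := by
    intro T' hT'
    obtain ⟨P, hP⟩ := hrep T' hT'
    obtain ⟨B, -, hB⟩ := hP.exists_bound_velocity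
    rw [eLpNorm_exponent_top]
    refine eLpNormEssSup_lt_top_of_ae_bound (C := B) ?_
    filter_upwards [ae_restrict_mem (measurableSet_Icc.prod MeasurableSet.univ)] with w hw
    obtain ⟨t, x⟩ := w
    exact hB t hw.1 x
  have hrate : ∀ t ∈ Set.Ico 0 T, ∃ x, cL / 2 * Real.sqrt ν / Real.sqrt (T - t) ≤ ‖u t x‖ := by
    intro t ht
    have h := hLer ν T hν hT u p ⟨hcl, hnext⟩ hLH hstrip t ht
    have ha : 0 < cL * Real.sqrt ν / Real.sqrt (T - t) := by
      have h1 : 0 < Real.sqrt ν := Real.sqrt_pos.2 hν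
      have h2 : 0 < Real.sqrt (T - t) := Real.sqrt_pos.2 (sub_pos.2 ht.2)
      positivity
    obtain ⟨x, hx⟩ := exists_half_le_norm_of_ofReal_le_eLpNorm_top ha h
    refine ⟨x, ?_⟩
    have heq : cL / 2 * Real.sqrt ν / Real.sqrt (T - t) =
        cL * Real.sqrt ν / Real.sqrt (T - t) / 2 := by ring
    rw [heq]
    exact hx
  -- (2) the quarter law in Frobenius form: Type-I enstrophy at EVERY time
  set K' : ℝ := max K 1 with hK'
  have hK'0 : 0 < K' := lt_of_lt_of_le one_pos (le_max_right _ _)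
  have hsν : 0 < ν * Real.sqrt ν := mul_pos hν (Real.sqrt_pos.2 hν)
  set C : ℝ := K' / (ν * Real.sqrt ν) with hC
  have hC0 : 0 < C := div_pos hK'0 hsν
  have hCid : ∀ t, C * (ν * Real.sqrt ν) / Real.sqrt (T - t) = K' / Real.sqrt (T - t) := by
    intro t
    rw [hC, div_mul_cancel₀ _ hsν.ne']
  have hfrob : ∀ s ∈ Set.Ico 0 T,
      (∫⁻ x, ENNReal.ofReal (frobeniusNormSq (fderiv ℝ (u s) x))) ≤
        ENNReal.ofReal (K / Real.sqrt (T - s)) := by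
    intro s hs
    have hs2 : ContDiff ℝ 2 (u s) := (hcl.contDiff_velocity hs).of_le (by norm_cast)
    have hL2 : ∫⁻ x, ‖u s x‖ₑ ^ 2 < ⊤ := by
      have hm : MemLp (u s) 2 volume := hLH.memLp s ⟨hs.1, hs.2.le⟩
      have h := lintegral_rpow_enorm_lt_top_of_eLpNorm_lt_top two_ne_zero ENNReal.ofNat_ne_top
        hm.eLpNorm_lt_top
      simpa [ENNReal.toReal_ofNat] using h
    exact (lintegral_frobeniusNormSq_fderiv_le_lintegral_sq_norm_curl hs2 (hcl.divFree s hs)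
      hL2).trans (hK s hs)
  have hIII : ∀ t' ∈ Set.Ico 0 T, ∃ t ∈ Set.Ico t' T, ∀ s ∈ Set.Icc 0 t,
      (∫⁻ x, ENNReal.ofReal (frobeniusNormSq (fderiv ℝ (u s) x))) ≤
        ENNReal.ofReal (C * (ν * Real.sqrt ν) / Real.sqrt (T - t)) := by
    intro t' ht'
    refine ⟨t', ⟨le_rfl, ht'.2⟩, fun s hs => ?_⟩
    have hsT : s ∈ Set.Ico 0 T := ⟨hs.1, hs.2.trans_lt ht'.2⟩
    refine (hfrob s hsT).trans (ENNReal.ofReal_le_ofReal ?_)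
    rw [hCid]
    have h1 : 0 < Real.sqrt (T - t') := Real.sqrt_pos.2 (sub_pos.2 ht'.2)
    have h2 : Real.sqrt (T - t') ≤ Real.sqrt (T - s) := Real.sqrt_le_sqrt (by linarith [hs.2])
    calc K / Real.sqrt (T - s) ≤ K' / Real.sqrt (T - s) :=
          div_le_div_of_nonneg_right (le_max_left _ _) (h1.le.trans h2)
      _ ≤ K' / Real.sqrt (T - t') := div_le_div_of_nonneg_left hK'0.le h1 h2
  -- (3) the Type-I-enstrophy branch: velocity-concentrated enstrophy-normalised zooms
  obtain ⟨tc, xc, L, s₀, θ, hs₀, hθ, htc, hL, hdom, hpast, hconc⟩ :=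
    stub_typeIBranch ν T hν hT u p hcl (cL / 2) (by positivity) hrate cP KP hcP hKP hpers' C hC0 hIII
  -- (4) a global velocity bound `B + C_I/√(T−t)` on `[0, T)` from the eventual Type-I rate
  obtain ⟨T₁, hT₁T, hIsub⟩ := mem_nhdsLT_iff_exists_Ioo_subset.1 hCI
  set T' : ℝ := max T₁ (T / 2) with hT'
  have hT'mem : T' ∈ Set.Ioo 0 T :=
    ⟨lt_of_lt_of_le (half_pos hT) (le_max_right _ _), max_lt hT₁T (half_lt_self hT)⟩
  obtain ⟨P, hP⟩ := hrep T' hT'mem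
  obtain ⟨B, hB0, hB⟩ := hP.exists_bound_velocity
  set CI' : ℝ := max CI 0 with hCI'
  have hCI'0 : 0 ≤ CI' := le_max_right _ _
  have hglob : ∀ t ∈ Set.Ico 0 T, ∀ x, ‖u t x‖ ≤ B + CI' / Real.sqrt (T - t) := by
    intro t ht x
    have hst : 0 < Real.sqrt (T - t) := Real.sqrt_pos.2 (sub_pos.2 ht.2)
    have hnn : 0 ≤ CI' / Real.sqrt (T - t) := div_nonneg hCI'0 hst.le
    by_cases htT' : t ≤ T'
    · exact (hB t ⟨ht.1, htT'⟩ x).trans (le_add_of_nonneg_right hnn)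
    · have htmem : t ∈ Set.Ioo T₁ T := ⟨lt_of_le_of_lt (le_max_left _ _) (not_le.1 htT'), ht.2⟩
      have h1 : ‖u t x‖ ≤ CI / Real.sqrt (T - t) := hIsub htmem x
      have h2 : CI / Real.sqrt (T - t) ≤ CI' / Real.sqrt (T - t) :=
        div_le_div_of_nonneg_right (le_max_left _ _) hst.le
      exact (h1.trans h2).trans (le_add_of_nonneg_left hB0)
  -- (5) the common tail, re-run: universal bound after one critical unit, zooms, KNSS limit
  obtain ⟨Cz, hCz⟩ := stub_zoomBound
  have hbd : ∀ n, ∀ t ∈ Set.Icc (ν ^ 3 / L n ^ 2) (tc n), ∀ x, ‖u t x‖ ≤ Cz * L n / ν :=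
    fun n t ht x => hCz ν T hν hT u p hcl hLH hdec hrep (tc n) (L n) (htc n).1 (htc n).2 (hL n)
      (hdom n) t ht x
  set z : ℕ → ℝ → EuclideanSpace ℝ (Fin 3) → EuclideanSpace ℝ (Fin 3) :=
    fun n s y => (ν / L n) • u (tc n + ν ^ 3 / L n ^ 2 * s) (xc n + (ν ^ 2 / L n) • y) with hz_def
  have hz : ∀ n s y, z n s y =
      (ν / L n) • u (tc n + ν ^ 3 / L n ^ 2 * s) (xc n + (ν ^ 2 / L n) • y) := fun n s y => rfl
  obtain ⟨φ, v, hφ, hconv, hmild, hsmooth, hens, hL6⟩ :=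
    stub_zoomLimit ν T hν hT u p hcl hLH hdec hrep tc xc L htc hL hdom hpast Cz hbd z hz
  refine ⟨v, hmild, hsmooth, hens, hL6, ?_, ?_, ?_⟩
  · -- non-triviality, read off at the rescaled time `s₀` and the origin
    intro hzero
    have hslice0 : v s₀ 0 = 0 := hzero _ hs₀ 0
    have hlim : Tendsto (fun n => ‖z (φ n) s₀ 0‖) atTop (𝓝 0) := by
      have h := (hconv _ hs₀ 0).norm
      rwa [hslice0, norm_zero] at h
    have hlow : ∀ n, θ ≤ ‖z (φ n) s₀ 0‖ := fun n => by
      have h := hconc (φ n)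
      simpa only [hz, smul_zero, add_zero] using h
    have hθle : θ ≤ 0 := ge_of_tendsto' hlim hlow
    linarith
  · -- the Type-I clock passes to the pointwise limit
    intro s hs y
    have hLtop : Tendsto L atTop atTop := tendsto_level_atTop hT htc hL hpast
    have hLφ : Tendsto (fun n => L (φ n)) atTop atTop := hLtop.comp hφ.tendsto_atTop
    have hpastφ : Tendsto (fun n => tc (φ n) * L (φ n) ^ 2) atTop atTop :=
      hpast.comp hφ.tendsto_atTop
    have hzb : ∀ᶠ n in atTop, Real.sqrt (-s) * ‖z (φ n) s y‖ ≤
        Real.sqrt (-s) * (ν * B / L (φ n)) + CI' / Real.sqrt ν := by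
      filter_upwards [hpastφ.eventually_ge_atTop (ν ^ 3 * (-s))] with n hn
      rw [hz]
      exact zoom_clock_bound hν hCI'0 (htc (φ n)).2 (hL (φ n)) hs hn hglob _
    have ha : Tendsto (fun n => Real.sqrt (-s) * ‖z (φ n) s y‖) atTop
        (𝓝 (Real.sqrt (-s) * ‖v s y‖)) :=
      ((hconv s hs y).norm).const_mul _
    have hb : Tendsto (fun n => Real.sqrt (-s) * (ν * B / L (φ n)) + CI' / Real.sqrt ν) atTop
        (𝓝 (Real.sqrt (-s) * 0 + CI' / Real.sqrt ν)) :=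
      ((tendsto_const_nhds.div_atTop hLφ).const_mul _).add tendsto_const_nhds
    rw [mul_zero, zero_add] at hb
    exact le_of_tendsto_of_tendsto ha hb hzb
  · -- the enstrophy clock passes to the limit by lower semicontinuity
    intro s hs
    have hLtop : Tendsto L atTop atTop := tendsto_level_atTop hT htc hL hpast
    have hpastφ : Tendsto (fun n => tc (φ n) * L (φ n) ^ 2) atTop atTop :=
      hpast.comp hφ.tendsto_atTop
    obtain ⟨N, hN⟩ := eventually_atTop.1 (hpastφ.eventually_ge_atTop (ν ^ 3 * (1 + -s)))
    have hν3 : 0 < ν ^ 3 := pow_pos hν 3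
    -- window facts for the indices `φ (k + N)`
    have hwin : ∀ k, ν ^ 3 * (1 + -s) ≤ tc (φ (k + N)) * L (φ (k + N)) ^ 2 := fun k =>
      hN (k + N) (Nat.le_add_left N k)
    have hτmem : ∀ k, tc (φ (k + N)) + ν ^ 3 / L (φ (k + N)) ^ 2 * s ∈
        Set.Icc (ν ^ 3 / L (φ (k + N)) ^ 2) (tc (φ (k + N))) := by
      intro k
      have hL2 : 0 < L (φ (k + N)) ^ 2 := pow_pos (hL _) 2
      have h1 : ν ^ 3 / L (φ (k + N)) ^ 2 * (1 + -s) ≤ tc (φ (k + N)) := by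
        rw [div_mul_eq_mul_div, div_le_iff₀ hL2]
        exact hwin k
      have e : ν ^ 3 / L (φ (k + N)) ^ 2 * (1 + -s) =
          ν ^ 3 / L (φ (k + N)) ^ 2 - ν ^ 3 / L (φ (k + N)) ^ 2 * s := by ring
      have h2 : ν ^ 3 / L (φ (k + N)) ^ 2 * s ≤ 0 :=
        mul_nonpos_of_nonneg_of_nonpos (div_pos hν3 hL2).le hs.le
      constructor <;> linarith
    have hτT : ∀ k, tc (φ (k + N)) + ν ^ 3 / L (φ (k + N)) ^ 2 * s ∈ Set.Ico 0 T := fun k =>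
      ⟨(div_pos hν3 (pow_pos (hL _) 2)).le.trans (hτmem k).1,
        (hτmem k).2.trans_lt (htc _).2⟩
    -- `C¹` zoom slices, uniform sup bound, Dirichlet bound
    have hC1 : ∀ k, ContDiff ℝ 1 (z (φ (k + N)) s) := by
      intro k
      have hu1 : ContDiff ℝ 1 (u (tc (φ (k + N)) + ν ^ 3 / L (φ (k + N)) ^ 2 * s)) :=
        (hcl.contDiff_velocity (hτT k)).of_le (by norm_cast)
      have hA : ContDiff ℝ 1 fun y : EuclideanSpace ℝ (Fin 3) =>
          xc (φ (k + N)) + (ν ^ 2 / L (φ (k + N))) • y :=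
        contDiff_const.add (contDiff_id.const_smul _)
      have h3 : ContDiff ℝ 1 fun y : EuclideanSpace ℝ (Fin 3) =>
          (ν / L (φ (k + N))) • u (tc (φ (k + N)) + ν ^ 3 / L (φ (k + N)) ^ 2 * s)
            (xc (φ (k + N)) + (ν ^ 2 / L (φ (k + N))) • y) :=
        (hu1.comp hA).const_smul (ν / L (φ (k + N)))
      have hzs : z (φ (k + N)) s = fun y => (ν / L (φ (k + N))) •
          u (tc (φ (k + N)) + ν ^ 3 / L (φ (k + N)) ^ 2 * s)
            (xc (φ (k + N)) + (ν ^ 2 / L (φ (k + N))) • y) := funext (hz _ s)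
      rw [hzs]
      exact h3
    have hsup : ∀ k y, ‖z (φ (k + N)) s y‖ ≤ Cz := by
      intro k y
      rw [hz, norm_smul, Real.norm_of_nonneg (div_pos hν (hL _)).le]
      have hb := hbd (φ (k + N)) _ (hτmem k) (xc (φ (k + N)) + (ν ^ 2 / L (φ (k + N))) • y)
      calc ν / L (φ (k + N)) * ‖u (tc (φ (k + N)) + ν ^ 3 / L (φ (k + N)) ^ 2 * s)
            (xc (φ (k + N)) + (ν ^ 2 / L (φ (k + N))) • y)‖
          ≤ ν / L (φ (k + N)) * (Cz * L (φ (k + N)) / ν) :=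
            mul_le_mul_of_nonneg_left hb (div_pos hν (hL _)).le
        _ = Cz := by
            have hL0 : L (φ (k + N)) ≠ 0 := (hL _).ne'
            field_simp
    have hvs : ContDiff ℝ 1 (v s) := by
      have h : ContDiff ℝ (⊤ : ℕ∞) (uncurry v ∘ fun y : EuclideanSpace ℝ (Fin 3) => (s, y)) :=
        hsmooth.comp_contDiff (contDiff_const.prodMk contDiff_id) fun y => ⟨hs, Set.mem_univ y⟩
      exact h.of_le (by exact_mod_cast le_top)
    set D : ℝ := max K 0 / (ν * Real.sqrt ν * Real.sqrt (-s)) with hD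
    have hD0 : 0 ≤ D := by positivity
    have hDz : ∀ k, ∫⁻ y, ENNReal.ofReal (frobeniusNormSq (fderiv ℝ (z (φ (k + N)) s) y)) ≤
        ENNReal.ofReal D := by
      intro k
      have hzs : z (φ (k + N)) s = (ν / L (φ (k + N))) • fun y =>
          u (tc (φ (k + N)) + ν ^ 3 / L (φ (k + N)) ^ 2 * s)
            (xc (φ (k + N)) + (ν ^ 2 / L (φ (k + N))) • y) := by
        funext y; simp only [hz, Pi.smul_apply]
      rw [hzs]
      exact zoom_enstrophy_bound hν (htc _).2 (hL _) hs (hτT k)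
        ((hcl.contDiff_velocity (hτT k)).differentiable (by simp)) (hfrob _ (hτT k)) _
    have h := lintegral_frobeniusNormSq_fderiv_le_of_tendsto_of_bound (D := ⟨D, hD0⟩) (C := Cz)
      (f := fun k => z (φ (k + N)) s) hC1 hvs hsup
      (fun y => (hconv s hs y).comp (tendsto_add_atTop_nat N))
      (fun k => by rw [ENNReal.coe_nnreal_eq]; exact hDz k)
    rwa [ENNReal.coe_nnreal_eq] at h

end QuarterZoomTypeIClock

open QuarterZoomTypeIClock

/-- **The route closes from `QuarterLawTypeI ∧ NoTypeII ∧ LRL`**, LRL = "Leray-rate Liouville in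
Galdi's parabolic class" (spelled inline): a bounded ancient mild solution (`ν = 1`), smooth on
`(−∞,0) × ℝ³`, with uniformly bounded slice enstrophy, `L⁶` slices, the velocity clock
`√(−s)‖v(s,y)‖ ≤ C'` AND the enstrophy clock `∫|∇v(s)|²_F ≤ K'/√(−s)`, vanishes identically.
Assembly via `quarterZoom_clocks_of_rate` and `navierStokesRegularity_of_noBlowup`. LRL is OPEN.
[cite: KochNadirashviliSereginSverak2009, §1 and §6] -/
theorem typeIQuarterGate_of_lerayRateLiouville
    (hQ : Summit.NavierStokesRegularity.NavierStokesRegularity.Theses.TypeIQuarterGate.QuarterLawTypeI)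
    (hII : Summit.NavierStokesRegularity.NavierStokesRegularity.Theses.TypeIQuarterGate.NoTypeII)
    (hLRL : ∀ v : ℝ → EuclideanSpace ℝ (Fin 3) → EuclideanSpace ℝ (Fin 3),
      IsBoundedAncientMildSolution 1 v →
      ContDiffOn ℝ (⊤ : ℕ∞) (Function.uncurry v) (Set.Iio 0 ×ˢ Set.univ) →
      (∃ C : NNReal, ∀ s < 0,
        ∫⁻ y, ENNReal.ofReal (frobeniusNormSq (fderiv ℝ (v s) y)) ≤ C) →
      (∀ s < 0, MemLp (v s) 6 volume) →
      (∃ C' : ℝ, 0 ≤ C' ∧ ∀ s < 0, ∀ y, Real.sqrt (-s) * ‖v s y‖ ≤ C') →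
      (∃ K' : ℝ, 0 ≤ K' ∧ ∀ s < 0, ∫⁻ y, ENNReal.ofReal (frobeniusNormSq (fderiv ℝ (v s) y)) ≤
        ENNReal.ofReal (K' / Real.sqrt (-s))) →
      ∀ s < 0, ∀ y, v s y = 0) :
    NavierStokesRegularity := by
  apply navierStokesRegularity_of_noBlowup
  intro ν T hν hT u p hcl hLH hdec
  by_contra hext
  have hmax : IsMaximalSmoothSolution ν 0 u p T := ⟨hcl, hext⟩
  have hI : IsTypeIBlowup u T := hII ν T hν hT u p hmax hLH hdec
  obtain ⟨K, hK⟩ := hQ ν T hν hT u p hmax hLH hdec hI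
  obtain ⟨CI, hCI⟩ := hI
  obtain ⟨v, hv, hsm, hens, hL6, hne, hclock, hensclock⟩ :=
    quarterZoom_clocks_of_rate ν T hν hT u p hcl hLH hdec hext CI hCI K hK
  have hsν : 0 < ν * Real.sqrt ν := mul_pos hν (Real.sqrt_pos.2 hν)
  refine hne (hLRL v hv hsm ⟨1, fun s hs => le_of_le_of_eq (hens s hs) ENNReal.coe_one.symm⟩ hL6
    ⟨max CI 0 / Real.sqrt ν, by positivity, hclock⟩
    ⟨max K 0 / (ν * Real.sqrt ν), by positivity, fun s hs => ?_⟩)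
  rw [div_div]
  exact hensclock s hs

/-- TQAL (Type-I-clock Liouville in the parabolic class) ⟹ LRL (drop the enstrophy clock); with
`typeIClockLiouville_of_parabolicGaldiLiouville`, X2 ⟹ TQAL ⟹ LRL. [folklore] -/
theorem lerayRateLiouville_of_typeIClockLiouville
    (hTQ : ∀ v : ℝ → EuclideanSpace ℝ (Fin 3) → EuclideanSpace ℝ (Fin 3),
      IsBoundedAncientMildSolution 1 v →
      ContDiffOn ℝ (⊤ : ℕ∞) (Function.uncurry v) (Set.Iio 0 ×ˢ Set.univ) →
      (∃ C : NNReal, ∀ s < 0,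
        ∫⁻ y, ENNReal.ofReal (frobeniusNormSq (fderiv ℝ (v s) y)) ≤ C) →
      (∀ s < 0, MemLp (v s) 6 volume) →
      (∃ C' : ℝ, 0 ≤ C' ∧ ∀ s < 0, ∀ y, Real.sqrt (-s) * ‖v s y‖ ≤ C') →
      ∀ s < 0, ∀ y, v s y = 0) :
    ∀ v : ℝ → EuclideanSpace ℝ (Fin 3) → EuclideanSpace ℝ (Fin 3),
      IsBoundedAncientMildSolution 1 v →
      ContDiffOn ℝ (⊤ : ℕ∞) (Function.uncurry v) (Set.Iio 0 ×ˢ Set.univ) →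
      (∃ C : NNReal, ∀ s < 0,
        ∫⁻ y, ENNReal.ofReal (frobeniusNormSq (fderiv ℝ (v s) y)) ≤ C) →
      (∀ s < 0, MemLp (v s) 6 volume) →
      (∃ C' : ℝ, 0 ≤ C' ∧ ∀ s < 0, ∀ y, Real.sqrt (-s) * ‖v s y‖ ≤ C') →
      (∃ K' : ℝ, 0 ≤ K' ∧ ∀ s < 0, ∫⁻ y, ENNReal.ofReal (frobeniusNormSq (fderiv ℝ (v s) y)) ≤
        ENNReal.ofReal (K' / Real.sqrt (-s))) →
      ∀ s < 0, ∀ y, v s y = 0 :=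
  fun v hv hsm hens hL6 hclock _ => hTQ v hv hsm hens hL6 hclock

end Summit.NavierStokesRegularity.NavierStokesRegularity.Theorems

end
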